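import Literature.Geometry.Lorentzian.KerrSeparatedPotentialCurvature
import Literature.Geometry.Lorentzian.KerrFrequencyRanges
import HarnessLib

/-!
# The structure of the full potential `V = V₀ + V₁` in the large superradiant range `𝓖^♯`
# (Dafermos–Rodnianski–Shlapentokh-Rothman, Lemma 8.3.1) and in the range `𝓖_𝄬` (proof of Prop. 8.5.1)

(family `gr`, infrastructure for statement **gr.S24**; namespace `Literature.Geometry.Lorentzian.Kerr`)

Dafermos–Rodnianski–Shlapentokh-Rothman (*Decay for solutions of the wave equation on Kerr exterior
spacetimes III*, arXiv:1402.7034 = Ann. of Math. 183 (2016)), Lemma 8.3.1: there is `δ > 0`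
depending only on `a₀`, `M` such that for `ω_high` sufficiently large and
`(ω, m, Λ) ∈ 𝓖^♯(ω_high)` (admissible, `Λ ≥ (ω₊ + α)⁻²ω²_high`, in the near-superradiant strip) the
full potential `V = V₀ + V₁` has a unique critical point `r_max` and satisfies
`V(r) − ω² ≥ bΛ` for `r ∈ (r_max − δ, r_max + δ)`,
`−(r − r_max) dV/dr ≥ bΛ(r − r_max)²/r⁴` for `r ≥ r₊`, and `|r_max − r⁰_max| ≤ BΛ⁻¹`, where
`r⁰_max` is the unique critical point of `V₀` (Lemmas 6.4.1, 6.4.2). The printed proof: refine the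
`V₀`-analysis of §6 (`dV₀/dr(r₊) ≥ ĉΛ`, the turning point `r₁` of the cubic
`P = (r² + a²)³dV₀/dr`, a point `r₁' ∈ (r₁, r⁰_max)` with `dV₀/dr ≥ cΛ` on `[r₊, r₁']` and
`dP/dr ≤ −c̃Λr²` on `[r₁', ∞)`), then add `V₁` using `|V₁| ≤ Br⁻³`, `|dV₁/dr| ≤ Br⁻⁴`,
`|d/dr((r² + a²)³dV₁/dr)| ≤ Br`: "for `ω_high` sufficiently large (and hence large `Λ`) … `V`
cannot have any critical points on `[r₊, r₁']` and has a unique maximum `r_max ∈ [r₁', ∞)` which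
satisfies `|r_max − r⁰_max| ≤ BΛ⁻¹`. The proof concludes by applying the fact that
`|dV/dr| ≤ BΛ`."

This file **proves** the lemma (`exists_sepPotential_structure_of_isNearSuperradiant'`) in the
following explicit form, for fixed `0 < M`, `0 ≤ a < M` (constants depending on `M, a`; the
source's uniformity in `a ∈ [0, a₀]` is not transcribed) and for the **repaired** strip
`0 < mω ≤ am²/(2Mr₊) + α|m|√Λ` of `KerrFrequencyRanges.lean` (for the printed strip the input
"`V₀(r⁰_max) − ω² ≥ cΛ`" (reallyNotTrapped) fails, `KerrFrequencyRanges.not_lemma_6_4_2_alpha_printed`),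
and with "`ω_high` sufficiently large" expressed as `Λ ≥ Λ₀` (in `𝓖^♯`,
`Λ ≥ (ω₊ + α)⁻²ω²_high`): there are `α₀ > 0`, `Λ₀`, `δ > 0`, `b > 0`, `B` such that for all
`0 ≤ α ≤ α₀` and all admissible triples in the strip with `Λ ≥ Λ₀` there are `r_max ∈ [r₊ + δ, 7M)`
("uniformly bounded away from `r₊` and … from above"), `r⁰_max ∈ (r₊, 7M)` with: `dV₀/dr(r⁰_max) = 0` and `r⁰_max` the maximum of `V₀` on `(r₊, ∞)`; `dV/dr > 0` on
`(r₊, r_max)`, `dV/dr(r_max) = 0`, `dV/dr < 0` on `(r_max, ∞)` (so `r_max` is the unique critical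
point of `V` and its maximum); `|r_max − r⁰_max| ≤ B/Λ`; `V − ω² ≥ bΛ` on `(r_max − δ, r_max + δ)`;
`bΛ(r − r_max)²/r⁴ ≤ −(r − r_max) dV/dr` for all `r > r₊`; and the non-degeneracy
`d²V/dr²(r_max) ≤ −bΛ` recorded in the parallel Lemma 8.6.1. Here `dV/dr` is the `r`-derivative; the
printed `V' = (Δ/(r² + a²)) dV/dr` (`' = d/dr*`) has the same sign and zeros on `(r₊, ∞)`.
`exists_sepPotential_structure_of_isFreqSharpSup'` is the same statement for
`(ω, m, Λ) ∈ 𝓖^♯(ω_high)` (`KerrFrequencyRanges.IsFreqSharpSup` with the repaired strip) and all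
`ω_high ≥ ω₀`, as printed.

The passage from `V₀` to `V` is isolated as `exists_sepPotential_structure_of_horizon_deriv` (inputs:
`P(r₊) ≥ KΛ` and a critical point `r⁰_max` of `V₀` with `V₀(r⁰_max) − ω² ≥ b₀Λ`; constants
depending on `M, a, K, b₀`), which the source re-uses for the range `𝓖_𝄬` in the proof of
Prop. 8.5.1 ("As in the proof of Proposition 8.3.1 … we again infer that … `V` has a unique
non-degenerate critical point at `r_max` …"): `exists_sepPotential_structure_of_mul_nonpos`
(`mω ≤ 0`, `ω² ≤ (16/(4225M²))Λ`, `Λ ≥ Λ₀`; with `V₀(r⁰_max) ≥ V₀(8M) ≥ 32Λ/(4225M²)`,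
`sepPotential₀_eight_mul_ge`) and `exists_sepPotential_structure_of_isFreqLessflat'`
(`(ω, m, Λ) ∈ 𝓖_𝄬(ω_high, ε)` with the repaired strip, `ε ≤ min(ε₀, α²)`, `ω_high ≥ ω₀`).

Ingredients: §6 as formalised in `KerrSeparatedTrapping.lean`/`KerrFrequencyRanges.lean`
(`exists_sepPotential₀_rmax_sub_sq_ge'`, `le_deriv_sepPotential₀_rPlus_alpha'`,
`exists_critPoly_turningPoint`), the bounds of `KerrSeparatedPotentialBounds.lean` and
`KerrSeparatedPotentialCurvature.lean`, and two quantitative complements proved here: the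
unimodality estimate `dP/dr(t) ≤ −4Λt(t − r)` for `t ≥ r` once `dP/dr(r) ≤ 0`
(`critPolyDeriv_le_of_nonpos`), and `P ≤ −Λr³/5` for `r ≥ 7M` (`critPoly_le_of_seven_mul_le`).

## References

* M. Dafermos, I. Rodnianski, Y. Shlapentokh-Rothman, arXiv:1402.7034 = Ann. of Math. 183
  (2016), §8.3, Lemma 8.3.1 and its proof; §8.5, proof of Prop. 8.5.1; §6.3–§6.4
  (key `DafermosRodnianskiShlapentokhrothman2014`).
-/

noncomputable section

open Set Filter Topology

namespace Literature.Geometry.Lorentzian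

namespace Kerr

/-! ### Quantitative complements to §6 -/

/-- **Quantitative unimodality of `P`**: if `dP/dr(r) ≤ 0` at some `r > 0` with `a² ≤ r²` then
`dP/dr(t) ≤ dP/dr(r) − 4Λt(t − r) ≤ −4Λt(t − r)` for all `t ≥ r` (`Λ ≥ 0`). With
`dP/dr(x) = −6Λx² + βx + γ`, `γ = 4a²m² − 2Λa² ≥ −2Λr²`, the hypothesis gives `β ≤ 8Λr`, whence
`dP/dr(t) − dP/dr(r) = (t − r)(β − 6Λ(t + r)) ≤ −4Λt(t − r)`. Sharpens
`critPolyDeriv_neg_of_nonpos` (DRSR arXiv:1402.7034, proof of Lemma 6.3.1) into the form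
"`dP/dr ≤ −c̃Λr²` on `[r₁', ∞)`" ((aProp2)) used in the proof of Lemma 8.3.1.
[cite: DafermosRodnianskiShlapentokhrothman2014, Lemma 8.3.1 (proof)] -/
theorem critPolyDeriv_le_of_nonpos {M a ω Λ r t : ℝ} {m : ℤ} (hΛ : 0 ≤ Λ) (hr : 0 < r)
    (har : a ^ 2 ≤ r ^ 2) (hPr : critPolyDeriv M a ω m Λ r ≤ 0) (hrt : r ≤ t) :
    critPolyDeriv M a ω m Λ t ≤ -(4 * Λ * t * (t - r)) := by
  set β := 12 * Λ * M - 24 * M * (a * m * ω) with hβ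
  have eP : ∀ x, critPolyDeriv M a ω m Λ x =
      -6 * Λ * x ^ 2 + β * x + (4 * a ^ 2 * (m : ℝ) ^ 2 - 2 * Λ * a ^ 2) := by
    intro x; simp only [critPolyDeriv, hβ]; ring
  have key : critPolyDeriv M a ω m Λ t =
      critPolyDeriv M a ω m Λ r + (t - r) * (β - 6 * Λ * (t + r)) := by
    rw [eP t, eP r]; ring
  have hβr : β * r ≤ 8 * Λ * r ^ 2 := by
    have h1 := eP r
    have h2 : 0 ≤ 4 * a ^ 2 * (m : ℝ) ^ 2 := by positivity
    have h3 : 2 * Λ * a ^ 2 ≤ 2 * Λ * r ^ 2 := by gcongr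
    nlinarith
  have hβ8 : β ≤ 8 * Λ * r := by
    by_contra h
    push Not at h
    have : 8 * Λ * r * r < β * r := mul_lt_mul_of_pos_right h hr
    nlinarith
  have hbr : β - 6 * Λ * (t + r) ≤ -(4 * Λ * t) := by nlinarith
  have hprod : (t - r) * (β - 6 * Λ * (t + r)) ≤ (t - r) * -(4 * Λ * t) :=
    mul_le_mul_of_nonneg_left hbr (sub_nonneg.2 hrt)
  rw [key]
  nlinarith

/-- **`P ≤ −Λr³/5` for `r ≥ 7M`** (`0 < M`, `|a| ≤ M`, admissible triple): a quantitative form of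
`critPoly_neg_of_seven_mul_le` (`|4maMω(a² − 3r²)| ≤ 6MΛr² ≤ (6/7)Λr³`, `4ra²m² ≤ (4/49)Λr³`,
`−2Λ(r³ + a²r − 3Mr² + Ma²) ≤ −(8/7)Λr³`). DRSR arXiv:1402.7034, Lemma 6.3.1 ("`r⁰_max ≤ B`").
[cite: DafermosRodnianskiShlapentokhrothman2014, Lemma 6.3.1] -/
theorem critPoly_le_of_seven_mul_le {M a ω Λ r : ℝ} {m : ℤ} (hM : 0 < M) (haM : |a| ≤ M)
    (hadm : IsAdmissibleTriple a ω m Λ) (hr : 7 * M ≤ r) :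
    critPoly M a ω m Λ r ≤ -(Λ * r ^ 3 / 5) := by
  have hr0 : 0 < r := by linarith
  have hΛ : 0 ≤ Λ := hadm.nonneg
  have ha2 : a ^ 2 ≤ M ^ 2 := by nlinarith [sq_abs a, abs_nonneg a]
  have hMr : M ≤ r / 7 := by linarith
  have hT1 : 4 * m * a * M * ω * (-3 * r ^ 2 + a ^ 2) ≤ 6 * M * Λ * r ^ 2 := by
    have e : 4 * m * a * M * ω * (-3 * r ^ 2 + a ^ 2) = (4 * M) * ((a * m * ω) * (-3 * r ^ 2 + a ^ 2)) := by
      ring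
    rw [e]
    have h1 : (a * m * ω) * (-3 * r ^ 2 + a ^ 2) ≤ |a * m * ω| * (3 * r ^ 2) := by
      have hb : |-3 * r ^ 2 + a ^ 2| ≤ 3 * r ^ 2 := by
        rw [abs_le]; constructor <;> nlinarith
      calc (a * m * ω) * (-3 * r ^ 2 + a ^ 2) ≤ |(a * m * ω) * (-3 * r ^ 2 + a ^ 2)| := le_abs_self _
        _ = |a * m * ω| * |-3 * r ^ 2 + a ^ 2| := abs_mul _ _
        _ ≤ |a * m * ω| * (3 * r ^ 2) := by gcongr
    have h2 : |a * ↑m * ω| * (3 * r ^ 2) ≤ (Λ / 2) * (3 * r ^ 2) := by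
      gcongr; linarith [hadm.2]
    nlinarith [h1.trans h2, hM.le]
  have hT2 : 4 * r * a ^ 2 * (m : ℝ) ^ 2 ≤ 4 * r * M ^ 2 * Λ := by
    have := hadm.sq_le
    gcongr
  have hT3 : -(2 * Λ * (r ^ 3 + a ^ 2 * r - 3 * M * r ^ 2 + M * a ^ 2)) ≤
      -(2 * Λ * (r ^ 3 - 3 * M * r ^ 2)) := by
    have : 0 ≤ a ^ 2 * r := by positivity
    have : 0 ≤ M * a ^ 2 := by positivity
    nlinarith
  have hM2 : M ^ 2 ≤ r ^ 2 / 49 := by nlinarith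
  unfold critPoly
  nlinarith [mul_nonneg hΛ (pow_nonneg hr0.le 2), mul_nonneg hΛ hr0.le,
    mul_le_mul_of_nonneg_left hMr (by positivity : (0 : ℝ) ≤ Λ * r ^ 2),
    mul_le_mul_of_nonneg_left hM2 (by positivity : (0 : ℝ) ≤ Λ * r)]

/-- **`|(r² + a²)³ dV₁/dr| ≤ 184Mr²`** for `0 < M ≤ r`, `|a| ≤ M`
(`(r² + a²)³ dV₁/dr = P₁/(r² + a²)²`, `|P₁| ≤ 184Mr⁶`). DRSR arXiv:1402.7034, proof of Lemma 8.3.1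
("`|dV₁/dr| ≤ Br⁻⁴`"). [cite: DafermosRodnianskiShlapentokhrothman2014, Lemma 8.3.1 (proof)] -/
theorem abs_cube_mul_deriv_sepPotential₁_le {M a r : ℝ} (hM : 0 < M) (haM : |a| ≤ M)
    (hr : M ≤ r) :
    |(r ^ 2 + a ^ 2) ^ 3 * deriv (sepPotential₁ M a) r| ≤ 184 * M * r ^ 2 := by
  have hr0 : 0 < r := hM.trans_le hr
  have hD : 0 < r ^ 2 + a ^ 2 := by positivity
  have hP := abs_critPoly₁_le hM haM hr
  have e : (r ^ 2 + a ^ 2) ^ 3 * deriv (sepPotential₁ M a) r =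
      critPoly₁ M a r / (r ^ 2 + a ^ 2) ^ 2 := by
    rw [deriv_sepPotential₁_eq M a hD.ne']
    field_simp
  rw [e, abs_div, abs_of_pos (pow_pos hD 2)]
  calc |critPoly₁ M a r| / (r ^ 2 + a ^ 2) ^ 2 ≤ 184 * M * r ^ 6 / (r ^ 2 + a ^ 2) ^ 2 := by gcongr
    _ ≤ 184 * M * r ^ 6 / (r ^ 2) ^ 2 := by
        apply div_le_div_of_nonneg_left (by positivity) (by positivity)
        gcongr; nlinarith [sq_nonneg a]
    _ = 184 * M * r ^ 2 := by field_simp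

/-- `(r² + a²)³ dV/dr = P + (r² + a²)³ dV₁/dr` for `r > 0`. [cite: DafermosRodnianskiShlapentokhrothman2014, §6.2] -/
theorem cube_mul_deriv_sepPotential_eq (M a ω : ℝ) (m : ℤ) (Λ : ℝ) {r : ℝ} (hr : 0 < r) :
    (r ^ 2 + a ^ 2) ^ 3 * deriv (sepPotential M a ω m Λ) r =
      critPoly M a ω m Λ r + (r ^ 2 + a ^ 2) ^ 3 * deriv (sepPotential₁ M a) r := by
  have hD : r ^ 2 + a ^ 2 ≠ 0 := by positivity
  rw [deriv_sepPotential_eq M a ω m Λ hD, deriv_sepPotential₁_eq M a hD]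
  field_simp

/-- **`V₀(8M) ≥ 32Λ/(4225M²)`** for `0 < M`, `|a| ≤ M` and an admissible triple, whatever the sign of
`mω` (`32M²·amω ≥ −16M²Λ`, `a²m² ≤ a²Λ`, `Δ(8M) = 48M² + a²`, `(64M² + a²)² ≤ 4225M⁴`): a
frequency-independent lower bound for the maximum of `V₀` on `(r₊, ∞)`, used for the range `𝓖_𝄬`
where `ω² < ε_width Λ` ("`ω² ≪ Λ`", DRSR arXiv:1402.7034, proof of Prop. 8.5.1: "the conclusions of
Lemma 6.4.2 still hold"). [cite: DafermosRodnianskiShlapentokhrothman2014, Prop. 8.5.1 (proof)] -/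
theorem sepPotential₀_eight_mul_ge {M a ω Λ : ℝ} {m : ℤ} (hM : 0 < M) (haM : |a| ≤ M)
    (hadm : IsAdmissibleTriple a ω m Λ) :
    32 * Λ / (4225 * M ^ 2) ≤ sepPotential₀ M a ω m Λ (8 * M) := by
  have hΛ : 0 ≤ Λ := hadm.nonneg
  have ha2 : a ^ 2 ≤ M ^ 2 := by nlinarith [sq_abs a, abs_nonneg a]
  have hD : 0 < (8 * M) ^ 2 + a ^ 2 := by positivity
  unfold sepPotential₀ delta
  rw [div_le_div_iff₀ (by positivity) (pow_pos hD 2)]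
  have h1 : -(16 * M ^ 2 * Λ) ≤ 4 * M * (8 * M) * a * m * ω := by
    have e : 4 * M * (8 * M) * a * m * ω = 32 * M ^ 2 * (a * m * ω) := by ring
    rw [e]
    have := neg_abs_le (a * m * ω)
    nlinarith [hadm.2, sq_nonneg M]
  have h2 : a ^ 2 * (m : ℝ) ^ 2 ≤ a ^ 2 * Λ := mul_le_mul_of_nonneg_left hadm.sq_le (sq_nonneg a)
  have h3 : ((8 * M) ^ 2 + a ^ 2) ^ 2 ≤ 4225 * M ^ 4 := by nlinarith
  have h4 : 32 * Λ * ((8 * M) ^ 2 + a ^ 2) ^ 2 ≤ 32 * Λ * (4225 * M ^ 4) :=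
    mul_le_mul_of_nonneg_left h3 (by positivity)
  nlinarith [mul_nonneg hΛ (sq_nonneg a), mul_nonneg hΛ (sq_nonneg M)]

/-! ### Sign data ⇒ monotonicity, for the full potential -/

/-- `V` is continuous on every subset of `(0, ∞)`. [folklore] -/
theorem continuousOn_sepPotential (M a ω : ℝ) (m : ℤ) (Λ : ℝ) {s : Set ℝ} (hs : s ⊆ Ioi 0) :
    ContinuousOn (sepPotential M a ω m Λ) s := fun x hx ↦
  (hasDerivAt_sepPotential M a ω m Λ
    (by have : (0 : ℝ) < x := hs hx; positivity)).continuousAt.continuousWithinAt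

/-- **From the sign data to the maximum** (the full-potential analogue of
`sepPotential₀_isMaxOn_of_deriv_sign`): if `dV/dr > 0` on `(r₊, r_max)` and `dV/dr < 0` on
`(r_max, ∞)` (`r₊ > 0`) then `V` is strictly increasing on `(r₊, r_max]`, strictly decreasing on
`[r_max, ∞)`, and `r_max` is the maximum of `V` on `(r₊, ∞)`. DRSR arXiv:1402.7034, Lemma 8.3.1
("`V` has a unique critical point `r_max`", a maximum). [cite: DafermosRodnianskiShlapentokhrothman2014, Lemma 8.3.1] -/
theorem sepPotential_isMaxOn_of_deriv_sign {M a ω Λ rmax : ℝ} {m : ℤ} (hr0 : 0 < rPlus M a)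
    (hp : rPlus M a < rmax)
    (hpos : ∀ r ∈ Ioo (rPlus M a) rmax, 0 < deriv (sepPotential M a ω m Λ) r)
    (hneg : ∀ r ∈ Ioi rmax, deriv (sepPotential M a ω m Λ) r < 0) :
    StrictMonoOn (sepPotential M a ω m Λ) (Ioc (rPlus M a) rmax) ∧
      StrictAntiOn (sepPotential M a ω m Λ) (Ici rmax) ∧
      IsMaxOn (sepPotential M a ω m Λ) (Ioi (rPlus M a)) rmax := by
  have hcont : ContinuousOn (sepPotential M a ω m Λ) (Ioi (rPlus M a)) :=
    continuousOn_sepPotential M a ω m Λ (Ioi_subset_Ioi hr0.le)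
  have h1 : StrictMonoOn (sepPotential M a ω m Λ) (Ioc (rPlus M a) rmax) :=
    strictMonoOn_of_deriv_pos (convex_Ioc _ _) (hcont.mono Ioc_subset_Ioi_self)
      (by rw [interior_Ioc]; exact hpos)
  have h2 : StrictAntiOn (sepPotential M a ω m Λ) (Ici rmax) :=
    strictAntiOn_of_deriv_neg (convex_Ici _) (hcont.mono fun x hx ↦ hp.trans_le hx)
      (by rw [interior_Ici]; exact hneg)
  refine ⟨h1, h2, isMaxOn_iff.2 fun r hr ↦ ?_⟩
  rcases lt_trichotomy r rmax with h | rfl | h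
  · exact (h1 ⟨hr, h.le⟩ ⟨hp, le_rfl⟩ h).le
  · exact le_rfl
  · exact (h2 self_mem_Ici h.le h).le

/-! ### Lemma 8.3.1: the core argument -/

/-- **The core of Lemma 8.3.1 (passage from `V₀` to `V = V₀ + V₁`), abstract in the §6 inputs.**
For `0 < M`, `0 ≤ a < M` and constants `K > 0`, `b₀ > 0` there are `Λ₀`, `δ > 0`, `b > 0`, `B`
(depending on `M, a, K, b₀` only) such that: for every admissible triple `(ω, m, Λ)` with `Λ ≥ Λ₀`
and `P(r₊) ≥ KΛ` (`P = (r² + a²)³dV₀/dr`; Lemma 6.4.1) and every `r⁰_max > r₊` with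
`dV₀/dr(r⁰_max) = 0` and `V₀(r⁰_max) − ω² ≥ b₀Λ` (Lemma 6.4.2), there is `r_max ∈ [r₊ + δ, 7M)` with
`r⁰_max < 7M`, `dV/dr > 0` on `(r₊, r_max)`, `dV/dr(r_max) = 0`, `dV/dr < 0` on `(r_max, ∞)`, `r_max`
the maximum of `V` on `(r₊, ∞)`, `|r_max − r⁰_max| ≤ B/Λ`, `V − ω² ≥ bΛ` on `(r_max − δ, r_max + δ)`,
`bΛ(r − r_max)²/r⁴ ≤ −(r − r_max)dV/dr` for `r > r₊`, and `d²V/dr²(r_max) ≤ −bΛ`. This is the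
argument of the proof of DRSR arXiv:1402.7034, Lemma 8.3.1 (turning point `r₁` of `P`, a point
`r₁' = r₁ + δ₂` with `P ≥ (K/2)Λ` on `[r₊, r₁']` and `dP/dr ≤ −c̃Λr²` on `[r₁', ∞)`, then the `V₁`-bounds
of `KerrSeparatedPotentialCurvature.lean` for `Λ` large), which the source re-uses verbatim for the
range `𝓖_𝄬` (proof of Prop. 8.5.1). Constants: `δ₂ = min(M, K/(5184M²))`, `c̃ = 2δ₂/(3M)`,
`δ₃ = b₀M³/96`, `B = 9016M/c̃`, `Λ₀ = max(132, 3584/c̃, 26496M³/K, 2B/δ₃)`, `δ = min(δ₃/2, δ₂)`,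
`b = min(b₀/2, c̃/48, K/(8064M³), c̃/(38416M⁴))`. [cite: DafermosRodnianskiShlapentokhrothman2014, Lemma 8.3.1 (proof)] -/
theorem exists_sepPotential_structure_of_horizon_deriv {M a K b₀ : ℝ} (hM : 0 < M) (ha0 : 0 ≤ a)
    (haM : a < M) (hK : 0 < K) (hb₀ : 0 < b₀) :
    ∃ Λ₀ : ℝ, ∃ δ > 0, ∃ b > 0, ∃ B : ℝ, ∀ (ω : ℝ) (m : ℤ) (Λ : ℝ), IsAdmissibleTriple a ω m Λ →
      Λ₀ ≤ Λ → K * Λ ≤ critPoly M a ω m Λ (rPlus M a) →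
      ∀ r0max : ℝ, rPlus M a < r0max → deriv (sepPotential₀ M a ω m Λ) r0max = 0 →
      b₀ * Λ ≤ sepPotential₀ M a ω m Λ r0max - ω ^ 2 →
      ∃ rmax : ℝ, rPlus M a < rmax ∧ rmax < 7 * M ∧ rPlus M a + δ ≤ rmax ∧ r0max < 7 * M ∧
        (∀ r ∈ Ioo (rPlus M a) rmax, 0 < deriv (sepPotential M a ω m Λ) r) ∧
        deriv (sepPotential M a ω m Λ) rmax = 0 ∧
        (∀ r ∈ Ioi rmax, deriv (sepPotential M a ω m Λ) r < 0) ∧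
        IsMaxOn (sepPotential M a ω m Λ) (Ioi (rPlus M a)) rmax ∧
        |rmax - r0max| ≤ B / Λ ∧
        (∀ r ∈ Ioo (rmax - δ) (rmax + δ), b * Λ ≤ sepPotential M a ω m Λ r - ω ^ 2) ∧
        (∀ r ∈ Ioi (rPlus M a),
          b * Λ * (r - rmax) ^ 2 / r ^ 4 ≤ -((r - rmax) * deriv (sepPotential M a ω m Λ) r)) ∧
        deriv (deriv (sepPotential M a ω m Λ)) rmax ≤ -(b * Λ) := by
  have haM' : |a| ≤ M := by rw [abs_of_nonneg ha0]; exact haM.le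
  have hMa : IsSubextremal M a := show |a| < M by rwa [abs_of_nonneg ha0]
  have ha2 : a ^ 2 ≤ M ^ 2 := by nlinarith only [haM, ha0]
  -- `r₊`
  have hrp : M < rPlus M a := by
    have : 0 < √(M ^ 2 - a ^ 2) := Real.sqrt_pos.2 (by nlinarith only [haM, ha0])
    unfold rPlus; linarith only [this]
  have hrp0 : 0 < rPlus M a := hM.trans hrp
  have hDp : 0 < rPlus M a ^ 2 + a ^ 2 := by positivity
  -- the constants
  obtain ⟨δ₂, hδ₂def⟩ : ∃ δ₂ : ℝ, δ₂ = min M (K / (5184 * M ^ 2)) := ⟨_, rfl⟩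
  have hδ₂0 : 0 < δ₂ := by rw [hδ₂def]; exact lt_min hM (by positivity)
  have hδ₂M : δ₂ ≤ M := by rw [hδ₂def]; exact min_le_left _ _
  have hδ₂B : 1296 * M ^ 2 * δ₂ ≤ K / 4 := by
    have h : δ₂ ≤ K / (5184 * M ^ 2) := by rw [hδ₂def]; exact min_le_right _ _
    rw [le_div_iff₀ (by positivity)] at h
    linarith only [h]
  obtain ⟨ct, hctdef⟩ : ∃ ct : ℝ, ct = 2 * δ₂ / (3 * M) := ⟨_, rfl⟩
  have hct0 : 0 < ct := by rw [hctdef]; positivity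
  obtain ⟨δ₃, hδ₃def⟩ : ∃ δ₃ : ℝ, δ₃ = b₀ * M ^ 3 / 96 := ⟨_, rfl⟩
  have hδ₃0 : 0 < δ₃ := by rw [hδ₃def]; positivity
  obtain ⟨Bc, hBcdef⟩ : ∃ Bc : ℝ, Bc = 9016 * M / ct := ⟨_, rfl⟩
  have hBc0 : 0 < Bc := by rw [hBcdef]; positivity
  obtain ⟨Λ₀, hΛ₀def⟩ : ∃ Λ₀ : ℝ,
      Λ₀ = max 132 (max (3584 / ct) (max (26496 * M ^ 3 / K) (2 * Bc / δ₃))) := ⟨_, rfl⟩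
  obtain ⟨δ, hδdef⟩ : ∃ δ : ℝ, δ = min (δ₃ / 2) δ₂ := ⟨_, rfl⟩
  have hδ0 : 0 < δ := by rw [hδdef]; exact lt_min (by positivity) hδ₂0
  obtain ⟨b, hbdef⟩ : ∃ b : ℝ,
      b = min (b₀ / 2) (min (ct / 48) (min (K / (8064 * M ^ 3)) (ct / (38416 * M ^ 4)))) :=
    ⟨_, rfl⟩
  have hb0 : 0 < b := by
    rw [hbdef]
    exact lt_min (by positivity) (lt_min (by positivity) (lt_min (by positivity) (by positivity)))
  have hb1 : b ≤ b₀ / 2 := by rw [hbdef]; exact min_le_left _ _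
  have hb2 : b ≤ ct / 48 := by rw [hbdef]; exact (min_le_right _ _).trans (min_le_left _ _)
  have hb3 : b ≤ K / (8064 * M ^ 3) := by
    rw [hbdef]; exact (min_le_right _ _).trans ((min_le_right _ _).trans (min_le_left _ _))
  have hb4 : b ≤ ct / (38416 * M ^ 4) := by
    rw [hbdef]; exact (min_le_right _ _).trans ((min_le_right _ _).trans (min_le_right _ _))
  refine ⟨Λ₀, δ, hδ0, b, hb0, Bc, fun ω m Λ hadm hΛ₀Λ hPrp r0max h0p h0d h0b ↦ ?_⟩
  -- unpack `Λ ≥ Λ₀`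
  have hΛ132 : 132 ≤ Λ := by
    refine le_trans ?_ hΛ₀Λ
    rw [hΛ₀def]
    exact le_max_left _ _
  have hΛct : 3584 / ct ≤ Λ := by
    refine le_trans ?_ hΛ₀Λ
    rw [hΛ₀def]
    exact (le_max_left _ _).trans (le_max_right _ _)
  have hΛB : 26496 * M ^ 3 / K ≤ Λ := by
    refine le_trans ?_ hΛ₀Λ
    rw [hΛ₀def]
    exact ((le_max_left _ _).trans (le_max_right _ _)).trans (le_max_right _ _)
  have hΛδ : 2 * Bc / δ₃ ≤ Λ := by
    refine le_trans ?_ hΛ₀Λ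
    rw [hΛ₀def]
    exact ((le_max_right _ _).trans (le_max_right _ _)).trans (le_max_right _ _)
  have hΛ : 0 < Λ := by linarith only [hΛ132]
  have h0pos : 0 < r0max := hrp0.trans h0p
  -- `r⁰_max < 7M` (`P(r⁰_max) = 0` while `P < 0` on `[7M, ∞)`)
  have hP0 : critPoly M a ω m Λ r0max = 0 :=
    (deriv_sepPotential₀_eq_zero_iff M a ω m Λ h0pos).1 h0d
  have h07 : r0max < 7 * M := by
    by_contra h
    push Not at h
    have := critPoly_neg_of_seven_mul_le hMa hadm hΛ h
    rw [hP0] at this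
    exact lt_irrefl _ this
  -- the turning point `c` of `P` and `r₁' = c + δ₂`
  obtain ⟨c, hcp, hc5, hPpos, hPc, -⟩ := exists_critPoly_turningPoint hMa hadm hΛ
  have hc0 : 0 < c := hrp0.trans_le hcp
  have hcM : M ≤ c := hrp.le.trans hcp
  obtain ⟨r₁, hr₁def⟩ : ∃ r₁ : ℝ, r₁ = c + δ₂ := ⟨_, rfl⟩
  have hr₁6 : r₁ ≤ 6 * M := by rw [hr₁def]; linarith only [hc5, hδ₂M]
  have hr₁p : rPlus M a + δ₂ ≤ r₁ := by rw [hr₁def]; linarith only [hcp]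
  have hr₁p' : rPlus M a < r₁ := by linarith only [hr₁p, hδ₂0]
  have hr₁0 : 0 < r₁ := hrp0.trans hr₁p'
  have hr₁M : M ≤ r₁ := hrp.le.trans hr₁p'.le
  have hr₁c : c ≤ r₁ := by rw [hr₁def]; linarith only [hδ₂0]
  -- `P ≥ (K/2)Λ` on `[r₊, r₁']`
  have hPmono : MonotoneOn (critPoly M a ω m Λ) (Icc (rPlus M a) c) :=
    monotoneOn_of_deriv_nonneg (convex_Icc _ _) (continuous_critPoly M a ω m Λ).continuousOn
      (fun x _ ↦ (hasDerivAt_critPoly M a ω m Λ x).differentiableAt.differentiableWithinAt)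
      (fun x hx ↦ by
        rw [interior_Icc] at hx
        rw [deriv_critPoly]
        exact (hPpos x ⟨hx.1.le, hx.2⟩).le)
  have hPcB : K * Λ ≤ critPoly M a ω m Λ c :=
    hPrp.trans (hPmono ⟨le_rfl, hcp⟩ ⟨hcp, le_rfl⟩ hcp)
  have hPlow : ∀ r ∈ Icc (rPlus M a) r₁, K / 2 * Λ ≤ critPoly M a ω m Λ r := by
    intro r hr
    have hB4 : K / 2 * Λ ≤ K * Λ :=
      mul_le_mul_of_nonneg_right (by linarith only [hK]) hΛ.le
    rcases le_or_gt r c with hrc | hrc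
    · exact hB4.trans (hPrp.trans (hPmono ⟨le_rfl, hcp⟩ ⟨hr.1, hrc⟩ hr.1))
    · have hmvt := (convex_Icc c r₁).mul_sub_le_image_sub_of_le_deriv
        (continuous_critPoly M a ω m Λ).continuousOn
        (fun x _ ↦ (hasDerivAt_critPoly M a ω m Λ x).differentiableAt.differentiableWithinAt)
        (C := -(1296 * Λ * M ^ 2))
        (fun x hx ↦ by
          rw [interior_Icc] at hx
          rw [deriv_critPoly]
          have hxM : M ≤ x := hcM.trans hx.1.le
          have hx6 : x ≤ 6 * M := hx.2.le.trans hr₁6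
          have habs := abs_critPolyDeriv_le hM haM' hadm hxM
          have hprod : 0 ≤ (6 * M - x) * (6 * M + x) :=
            mul_nonneg (by linarith only [hx6]) (by linarith only [hxM, hM])
          have hx2 : x ^ 2 ≤ 36 * M ^ 2 := by nlinarith only [hprod]
          have h36 := mul_le_mul_of_nonneg_left hx2 (by positivity : (0 : ℝ) ≤ 36 * Λ)
          linarith only [habs, h36, neg_abs_le (critPolyDeriv M a ω m Λ x)])
        c (left_mem_Icc.2 hr₁c) r ⟨hrc.le, hr.2⟩ hrc.le
      have hrc' : r - c ≤ δ₂ := by rw [hr₁def] at hr; linarith only [hr.2]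
      have h1 : 1296 * Λ * M ^ 2 * (r - c) ≤ 1296 * Λ * M ^ 2 * δ₂ :=
        mul_le_mul_of_nonneg_left hrc' (by positivity)
      have h2 := mul_le_mul_of_nonneg_left hδ₂B hΛ.le
      have h3 : 0 ≤ K * Λ := by positivity
      linarith only [hmvt, hPcB, h1, h2, h3]
  -- `dP/dr ≤ −c̃Λt²` on `[r₁', ∞)` (quantitative unimodality)
  have hP'far : ∀ t ∈ Ici r₁, critPolyDeriv M a ω m Λ t ≤ -(ct * Λ * t ^ 2) := by
    intro t ht
    have hct' : r₁ ≤ t := ht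
    have hct2 : c + δ₂ ≤ t := by rw [hr₁def] at hct'; exact hct'
    have ht0 : 0 < t := hr₁0.trans_le hct'
    have hac : a ^ 2 ≤ c ^ 2 := ha2.trans (pow_le_pow_left₀ hM.le hcM 2)
    have h1 := critPolyDeriv_le_of_nonpos hΛ.le hc0 hac hPc
      (show c ≤ t by linarith only [hct2, hδ₂0])
    have h2 : δ₂ * t ≤ (t - c) * (6 * M) := by
      have e0 : 0 ≤ c * (t - (c + δ₂)) := mul_nonneg hc0.le (by linarith only [hct2])
      have e1 : δ₂ * t ≤ (t - c) * (c + δ₂) := by linarith only [e0]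
      have hc6 : c + δ₂ ≤ 6 * M := by rw [hr₁def] at hr₁6; exact hr₁6
      have e2 : (t - c) * (c + δ₂) ≤ (t - c) * (6 * M) :=
        mul_le_mul_of_nonneg_left hc6 (by linarith only [hct2, hδ₂0])
      exact e1.trans e2
    have h3 : 4 * Λ * t * (δ₂ * t) ≤ 4 * Λ * t * ((t - c) * (6 * M)) :=
      mul_le_mul_of_nonneg_left h2 (by positivity)
    have e : ct * Λ * t ^ 2 = 4 * Λ * t * (δ₂ * t) / (6 * M) := by
      rw [hctdef]; field_simp; ring
    have h4 : ct * Λ * t ^ 2 ≤ 4 * Λ * t * (t - c) := by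
      rw [e, div_le_iff₀ (by positivity)]; linarith only [h3]
    exact h1.trans (neg_le_neg h4)
  -- the function `g = (r² + a²)³ dV/dr`
  set V := sepPotential M a ω m Λ with hV
  set g : ℝ → ℝ := fun s ↦ (s ^ 2 + a ^ 2) ^ 3 * deriv V s with hg
  have hg_eq : ∀ s, 0 < s → g s = critPoly M a ω m Λ s +
      (s ^ 2 + a ^ 2) ^ 3 * deriv (sepPotential₁ M a) s :=
    fun s hs ↦ cube_mul_deriv_sepPotential_eq M a ω m Λ hs
  have hg_hasDeriv : ∀ s, 0 < s → HasDerivAt g (deriv g s) s := fun s hs ↦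
    (hasDerivAt_cube_mul_deriv_sepPotential M a ω m Λ hs).differentiableAt.hasDerivAt
  have hg_cont : ContinuousOn g (Ioi 0) := fun s hs ↦
    ((hasDerivAt_cube_mul_deriv_sepPotential M a ω m Λ
      (show (0 : ℝ) < s from hs)).continuousAt).continuousWithinAt
  have hg'_le : ∀ s, M ≤ s → deriv g s ≤ critPolyDeriv M a ω m Λ s + 1792 * M * s :=
    fun s hs ↦ by
    have h := abs_deriv_cube_mul_deriv_sepPotential_sub_le (ω := ω) (Λ := Λ) (m := m) hM haM' hs
    have h' := (abs_sub_le_iff.1 h).1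
    linarith only [h']
  have hVg : ∀ s, 0 < s → deriv V s = g s / (s ^ 2 + a ^ 2) ^ 3 := fun s hs ↦ by
    have hDs : (s ^ 2 + a ^ 2) ^ 3 ≠ 0 := by positivity
    rw [hg, mul_div_cancel_left₀ _ hDs]
  -- `g ≥ (K/4)Λ` on `[r₊, r₁']`
  have hglow : ∀ r ∈ Icc (rPlus M a) r₁, K / 4 * Λ ≤ g r := by
    intro r hr
    have hrM : M ≤ r := hrp.le.trans hr.1
    have hr0 : 0 < r := hM.trans_le hrM
    have hr6 : r ≤ 6 * M := hr.2.trans hr₁6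
    rw [hg_eq r hr0]
    have h1 := hPlow r hr
    have h2 := abs_cube_mul_deriv_sepPotential₁_le hM haM' hrM
    have hprod : 0 ≤ (6 * M - r) * (6 * M + r) :=
      mul_nonneg (by linarith only [hr6]) (by linarith only [hrM, hM])
    have hr2 : r ^ 2 ≤ 36 * M ^ 2 := by nlinarith only [hprod]
    have h3 := mul_le_mul_of_nonneg_left hr2 (by positivity : (0 : ℝ) ≤ 184 * M)
    have h4 : 6624 * M ^ 3 ≤ K / 4 * Λ := by
      rw [div_le_iff₀ hK] at hΛB
      linarith only [hΛB]
    linarith only [h1, h2, h3, h4, neg_abs_le ((r ^ 2 + a ^ 2) ^ 3 * deriv (sepPotential₁ M a) r)]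
  -- `dg/dr ≤ −(c̃/2)Λs²` on `[r₁', ∞)`
  have hg'far : ∀ s ∈ Ici r₁, deriv g s ≤ -(ct / 2 * Λ * s ^ 2) := by
    intro s hs
    have hsM : M ≤ s := hr₁M.trans hs
    have h1 := hg'_le s hsM
    have h2 := hP'far s hs
    have hctΛ : 3584 ≤ ct * Λ := by
      rw [div_le_iff₀ hct0] at hΛct; linarith only [hΛct]
    have hs0 : 0 < s := hM.trans_le hsM
    have e1 : 3584 * (M * s) ≤ ct * Λ * (M * s) :=
      mul_le_mul_of_nonneg_right hctΛ (by positivity)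
    have e2 : ct * Λ * (M * s) ≤ ct * Λ * (s * s) := by
      apply mul_le_mul_of_nonneg_left _ (by positivity)
      exact mul_le_mul_of_nonneg_right hsM (by linarith only [hsM, hM])
    linarith only [h1, h2, e1, e2]
  -- `g < 0` on `[7M, ∞)`
  have hgneg7 : ∀ r, 7 * M ≤ r → g r < 0 := by
    intro r hr
    have hr0 : 0 < r := by linarith only [hr, hM]
    have hrM : M ≤ r := by linarith only [hr, hM]
    rw [hg_eq r hr0]
    have h1 := critPoly_le_of_seven_mul_le hM haM' hadm hr
    have h2 := abs_cube_mul_deriv_sepPotential₁_le hM haM' hrM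
    have h3 : 920 * M < Λ * r := by
      nlinarith only [hΛ132, hr, hM, mul_nonneg (sub_nonneg.2 hΛ132) (sub_nonneg.2 hr)]
    have h4 := mul_lt_mul_of_pos_right h3 (pow_pos hr0 2)
    linarith only [h1, h2, h4, le_abs_self ((r ^ 2 + a ^ 2) ^ 3 * deriv (sepPotential₁ M a) r)]
  -- `g` is strictly decreasing on `[r₁', ∞)`
  have hganti : StrictAntiOn g (Ici r₁) :=
    strictAntiOn_of_deriv_neg (convex_Ici _) (hg_cont.mono fun x hx ↦ hr₁0.trans_le hx)
      (fun x hx ↦ by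
        rw [interior_Ici] at hx
        have hx' : r₁ < x := hx
        have hx0 : 0 < x := hr₁0.trans hx'
        have h1 := hg'far x hx'.le
        have h2 : 0 < ct / 2 * Λ * x ^ 2 := by positivity
        linarith only [h1, h2])
  -- `r_max`: the zero of `g` in `(r₁', 7M)`
  have hr₁7 : r₁ ≤ 7 * M := by linarith only [hr₁6, hM]
  have hgr₁ : 0 < g r₁ :=
    lt_of_lt_of_le (by positivity) (hglow r₁ ⟨hr₁p'.le, le_rfl⟩)
  have hg7 : g (7 * M) < 0 := hgneg7 _ le_rfl
  obtain ⟨rmax, hrmax, hgrmax⟩ : ∃ rmax ∈ Ioo r₁ (7 * M), g rmax = 0 := by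
    have hcont7 : ContinuousOn g (Icc r₁ (7 * M)) := hg_cont.mono fun x hx ↦ hr₁0.trans_le hx.1
    exact intermediate_value_Ioo' hr₁7 hcont7 ⟨hg7, hgr₁⟩
  have hrmax0 : 0 < rmax := hr₁0.trans hrmax.1
  have hrmaxp : rPlus M a < rmax := hr₁p'.trans hrmax.1
  have hrmaxM : M ≤ rmax := hr₁M.trans hrmax.1.le
  have hDm : 0 < rmax ^ 2 + a ^ 2 := by positivity
  -- the sign of `dV/dr`
  have hgpos : ∀ r ∈ Ioo (rPlus M a) rmax, 0 < g r := by
    intro r hr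
    rcases le_or_gt r r₁ with h | h
    · exact lt_of_lt_of_le (by positivity) (hglow r ⟨hr.1.le, h⟩)
    · have := hganti (show r ∈ Ici r₁ from h.le) (show rmax ∈ Ici r₁ from hrmax.1.le) hr.2
      linarith only [this, hgrmax]
  have hgneg : ∀ r ∈ Ioi rmax, g r < 0 := by
    intro r hr
    have hr' : rmax < r := hr
    have := hganti (show rmax ∈ Ici r₁ from hrmax.1.le)
      (show r ∈ Ici r₁ from (hrmax.1.trans hr').le) hr'
    linarith only [this, hgrmax]
  have hVpos : ∀ r ∈ Ioo (rPlus M a) rmax, 0 < deriv V r := by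
    intro r hr
    have hr0 : 0 < r := hrp0.trans hr.1
    rw [hVg r hr0]
    exact div_pos (hgpos r hr) (by positivity)
  have hVzero : deriv V rmax = 0 := by rw [hVg rmax hrmax0, hgrmax, zero_div]
  have hVneg : ∀ r ∈ Ioi rmax, deriv V r < 0 := by
    intro r hr
    have hr0 : 0 < r := hrmax0.trans hr
    rw [hVg r hr0]
    exact div_neg_of_neg_of_pos (hgneg r hr) (by positivity)
  have hVmax := sepPotential_isMaxOn_of_deriv_sign (ω := ω) (m := m) (Λ := Λ) hrp0 hrmaxp
    hVpos hVneg
  -- `|r_max − r⁰_max| ≤ B/Λ`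
  have h0r₁ : r₁ < r0max := by
    by_contra h
    push Not at h
    have h1 := hPlow r0max ⟨h0p.le, h⟩
    have h2 : 0 < K / 2 * Λ := by positivity
    rw [hP0] at h1
    linarith only [h1, h2]
  have hPanti := (convex_Ici r₁).image_sub_le_mul_sub_of_deriv_le
    (continuous_critPoly M a ω m Λ).continuousOn
    (fun x _ ↦ (hasDerivAt_critPoly M a ω m Λ x).differentiableAt.differentiableWithinAt)
    (C := -(ct * Λ * M ^ 2))
    (fun x hx ↦ by
      rw [interior_Ici] at hx
      have hx' : r₁ < x := hx
      rw [deriv_critPoly]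
      have h1 := hP'far x hx'.le
      have hxM : M ≤ x := hr₁M.trans hx'.le
      have h2 : ct * Λ * M ^ 2 ≤ ct * Λ * x ^ 2 := by
        apply mul_le_mul_of_nonneg_left _ (by positivity)
        exact pow_le_pow_left₀ hM.le hxM 2
      linarith only [h1, h2])
  have hPrmax : |critPoly M a ω m Λ rmax| ≤ 9016 * M ^ 3 := by
    have e : critPoly M a ω m Λ rmax =
        -((rmax ^ 2 + a ^ 2) ^ 3 * deriv (sepPotential₁ M a) rmax) := by
      have := hg_eq rmax hrmax0; linarith only [this, hgrmax]
    rw [e, abs_neg]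
    have h2 := abs_cube_mul_deriv_sepPotential₁_le hM haM' hrmaxM
    have hprod : 0 ≤ (7 * M - rmax) * (7 * M + rmax) :=
      mul_nonneg (by linarith only [hrmax.2]) (by linarith only [hrmaxM, hM])
    have hr2 : rmax ^ 2 ≤ 49 * M ^ 2 := by nlinarith only [hprod]
    have h3 := mul_le_mul_of_nonneg_left hr2 (by positivity : (0 : ℝ) ≤ 184 * M)
    linarith only [h2, h3]
  have hdist : |rmax - r0max| ≤ Bc / Λ := by
    have hkey : ct * Λ * M ^ 2 * |rmax - r0max| ≤ 9016 * M ^ 3 := by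
      rcases le_or_gt rmax r0max with h | h
      · have h1 := hPanti rmax (show rmax ∈ Ici r₁ from hrmax.1.le) r0max
          (show r0max ∈ Ici r₁ from h0r₁.le) h
        rw [hP0] at h1
        rw [abs_of_nonpos (sub_nonpos.2 h)]
        linarith only [h1, hPrmax, le_abs_self (critPoly M a ω m Λ rmax)]
      · have h1 := hPanti r0max (show r0max ∈ Ici r₁ from h0r₁.le) rmax
          (show rmax ∈ Ici r₁ from hrmax.1.le) h.le
        rw [hP0] at h1
        rw [abs_of_pos (sub_pos.2 h)]
        linarith only [h1, hPrmax, neg_abs_le (critPoly M a ω m Λ rmax)]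
    have e : Bc / Λ = 9016 * M ^ 3 / (ct * Λ * M ^ 2) := by
      rw [hBcdef]; field_simp
    rw [e, le_div_iff₀ (by positivity)]
    linarith only [hkey]
  -- (1) `V − ω² ≥ bΛ` on `(r_max − δ, r_max + δ)`
  have hBcΛ : Bc / Λ ≤ δ₃ / 2 := by
    rw [div_le_iff₀ hδ₃0] at hΛδ
    rw [div_le_iff₀ hΛ]
    linarith only [hΛδ]
  have hδδ₃ : δ ≤ δ₃ / 2 := by rw [hδdef]; exact min_le_left _ _
  have hδδ₂ : δ ≤ δ₂ := by rw [hδdef]; exact min_le_right _ _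
  have hV₀lip : ∀ x ∈ Ioi (rPlus M a), ∀ y ∈ Ioi (rPlus M a),
      ‖sepPotential₀ M a ω m Λ y - sepPotential₀ M a ω m Λ x‖ ≤ 24 * Λ / M ^ 3 * ‖y - x‖ := by
    intro x hx y hy
    refine Convex.norm_image_sub_le_of_norm_deriv_le (fun z hz ↦ ?_) (fun z hz ↦ ?_)
      (convex_Ioi _) hx hy
    · have hz0 : (0 : ℝ) < z := hrp0.trans hz
      exact (hasDerivAt_sepPotential₀_critPoly M a ω m Λ
        (by positivity : z ^ 2 + a ^ 2 ≠ 0)).differentiableAt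
    · have hzM : M ≤ z := hrp.le.trans (le_of_lt hz)
      have hz0 : 0 < z := hM.trans_le hzM
      rw [Real.norm_eq_abs]
      refine (abs_deriv_sepPotential₀_le hM haM' hadm hzM).trans ?_
      apply div_le_div_of_nonneg_left (by positivity) (by positivity)
      exact pow_le_pow_left₀ hM.le hzM 3
  have hnear : ∀ r ∈ Ioo (rmax - δ) (rmax + δ), b * Λ ≤ V r - ω ^ 2 := by
    intro r hr
    have hrp' : rPlus M a < r := by linarith only [hr.1, hr₁p, hrmax.1, hδδ₂]
    have hr0 : 0 < r := hrp0.trans hrp'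
    have hclose : |r - r0max| ≤ δ₃ := by
      have h1 : |r - rmax| ≤ δ := by
        rw [abs_le]; constructor <;> linarith only [hr.1, hr.2]
      calc |r - r0max| = |(r - rmax) + (rmax - r0max)| := by congr 1; ring
        _ ≤ |r - rmax| + |rmax - r0max| := abs_add_le _ _
        _ ≤ δ + Bc / Λ := add_le_add h1 hdist
        _ ≤ δ₃ / 2 + δ₃ / 2 := add_le_add hδδ₃ hBcΛ
        _ = δ₃ := by ring
    have hlip := hV₀lip r0max h0p r hrp'
    rw [Real.norm_eq_abs, Real.norm_eq_abs] at hlip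
    have h1 : 24 * Λ / M ^ 3 * |r - r0max| ≤ b₀ * Λ / 4 := by
      calc 24 * Λ / M ^ 3 * |r - r0max| ≤ 24 * Λ / M ^ 3 * δ₃ := by gcongr
        _ = b₀ * Λ / 4 := by rw [hδ₃def]; field_simp; ring
    have h2 : sepPotential₀ M a ω m Λ r0max - b₀ * Λ / 4 ≤ sepPotential₀ M a ω m Λ r := by
      linarith only [hlip, h1,
        neg_abs_le (sepPotential₀ M a ω m Λ r - sepPotential₀ M a ω m Λ r0max)]
    have h3 : sepPotential₀ M a ω m Λ r ≤ V r := by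
      rw [hV, sepPotential]
      linarith only [sepPotential₁_nonneg haM' hrp'.le]
    have h4 : b * Λ ≤ b₀ / 2 * Λ := mul_le_mul_of_nonneg_right hb1 hΛ.le
    have h5 : 0 < b₀ * Λ := mul_pos hb₀ hΛ
    linarith only [h0b, h2, h3, h4, h5]
  -- (2) `bΛ(r − r_max)²/r⁴ ≤ −(r − r_max) dV/dr`
  have hGd : ∀ x, 0 < x → HasDerivAt (fun s ↦ g s + ct / 6 * Λ * s ^ 3)
      (deriv g x + ct / 2 * Λ * x ^ 2) x := fun x hx ↦
    ((hg_hasDeriv x hx).add ((hasDerivAt_pow 3 x).const_mul (ct / 6 * Λ))).congr_deriv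
      (by push_cast; ring)
  have hGanti : AntitoneOn (fun s ↦ g s + ct / 6 * Λ * s ^ 3) (Ici r₁) := by
    refine antitoneOn_of_deriv_nonpos (convex_Ici _) (fun x hx ↦ ?_) (fun x hx ↦ ?_)
      (fun x hx ↦ ?_)
    · exact (hGd x (hr₁0.trans_le hx)).continuousAt.continuousWithinAt
    · rw [interior_Ici] at hx
      exact (hGd x (hr₁0.trans hx)).differentiableAt.differentiableWithinAt
    · rw [interior_Ici] at hx
      have hx' : r₁ < x := hx
      rw [(hGd x (hr₁0.trans hx')).deriv]
      have h1 := hg'far x hx'.le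
      linarith only [h1]
  have hGrmax : g rmax + ct / 6 * Λ * rmax ^ 3 = ct / 6 * Λ * rmax ^ 3 := by
    rw [hgrmax, zero_add]
  have hVdeg : ∀ r ∈ Ioi (rPlus M a),
      b * Λ * (r - rmax) ^ 2 / r ^ 4 ≤ -((r - rmax) * deriv V r) := by
    intro r hr
    have hr' : rPlus M a < r := hr
    have hrM : M ≤ r := hrp.le.trans hr'.le
    have hr0 : 0 < r := hM.trans_le hrM
    have hD : 0 < r ^ 2 + a ^ 2 := by positivity
    have har : a ^ 2 ≤ r ^ 2 := ha2.trans (pow_le_pow_left₀ hM.le hrM 2)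
    have hD8 : (r ^ 2 + a ^ 2) ^ 3 ≤ 8 * r ^ 6 := by
      have h2r : r ^ 2 + a ^ 2 ≤ 2 * r ^ 2 := by linarith only [har]
      calc (r ^ 2 + a ^ 2) ^ 3 ≤ (2 * r ^ 2) ^ 3 := by gcongr
        _ = 8 * r ^ 6 := by ring
    rw [hVg r hr0]
    rcases lt_or_ge r r₁ with hrr₁ | hrr₁
    · -- near the horizon: `g ≥ (K/4)Λ`
      have hgr := hglow r ⟨hr'.le, hrr₁.le⟩
      have hgr0 : 0 ≤ g r := le_trans (by positivity) hgr
      have hrm : 0 ≤ rmax - r := by linarith only [hrmax.1, hrr₁]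
      have hrm7 : rmax - r ≤ 7 * M := by linarith only [hrmax.2, hr0]
      have hr6 : r ≤ 6 * M := hrr₁.le.trans hr₁6
      have e : -((r - rmax) * (g r / (r ^ 2 + a ^ 2) ^ 3)) =
          (rmax - r) * g r / (r ^ 2 + a ^ 2) ^ 3 := by ring
      rw [e]
      have step1 : b * Λ * (r - rmax) ^ 2 / r ^ 4 ≤
          K / (8064 * M ^ 3) * Λ * (rmax - r) ^ 2 / r ^ 4 := by
        have : (r - rmax) ^ 2 = (rmax - r) ^ 2 := by ring
        rw [this]
        gcongr
      have step2 : K / (8064 * M ^ 3) * Λ * (rmax - r) ^ 2 / r ^ 4 ≤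
          (rmax - r) * (K / 4 * Λ) / (8 * r ^ 6) := by
        rw [div_le_div_iff₀ (by positivity) (by positivity)]
        have hprod : 0 ≤ (6 * M - r) * (6 * M + r) :=
          mul_nonneg (by linarith only [hr6]) (by linarith only [hrM, hM])
        have hr2 : r ^ 2 ≤ 36 * M ^ 2 := by nlinarith only [hprod]
        have hkey : (rmax - r) * r ^ 2 ≤ 252 * M ^ 3 := by
          calc (rmax - r) * r ^ 2 ≤ (7 * M) * (36 * M ^ 2) :=
                mul_le_mul hrm7 hr2 (by positivity) (by positivity)
            _ = 252 * M ^ 3 := by ring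
        have e1 : K / (8064 * M ^ 3) * Λ * (rmax - r) ^ 2 * (8 * r ^ 6) =
            (K * Λ * (rmax - r) * r ^ 4 / (1008 * M ^ 3)) * ((rmax - r) * r ^ 2) := by
          field_simp; ring
        have e2 : (rmax - r) * (K / 4 * Λ) * r ^ 4 =
            (K * Λ * (rmax - r) * r ^ 4 / (1008 * M ^ 3)) * (252 * M ^ 3) := by
          field_simp; ring
        rw [e1, e2]
        exact mul_le_mul_of_nonneg_left hkey (by positivity)
      have step3 : (rmax - r) * (K / 4 * Λ) / (8 * r ^ 6) ≤
          (rmax - r) * g r / (r ^ 2 + a ^ 2) ^ 3 := by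
        calc (rmax - r) * (K / 4 * Λ) / (8 * r ^ 6) ≤ (rmax - r) * g r / (8 * r ^ 6) :=
              div_le_div_of_nonneg_right (mul_le_mul_of_nonneg_left hgr hrm) (by positivity)
          _ ≤ (rmax - r) * g r / (r ^ 2 + a ^ 2) ^ 3 :=
              div_le_div_of_nonneg_left (mul_nonneg hrm hgr0) (by positivity) hD8
      exact step1.trans (step2.trans step3)
    · -- `r ≥ r₁'`: compare `G(r)` with `G(r_max)`
      have hb48 : b * Λ * (r - rmax) ^ 2 / r ^ 4 ≤ ct / 48 * Λ * (r - rmax) ^ 2 / r ^ 4 := by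
        gcongr
      have e48 : ct / 48 * Λ * (r - rmax) ^ 2 / r ^ 4 =
          ct / 6 * Λ * (r - rmax) ^ 2 * r ^ 2 / (8 * r ^ 6) := by
        field_simp; ring
      have step2 : ct / 6 * Λ * (r - rmax) ^ 2 * r ^ 2 / (8 * r ^ 6) ≤
          ct / 6 * Λ * (r - rmax) ^ 2 * r ^ 2 / (r ^ 2 + a ^ 2) ^ 3 :=
        div_le_div_of_nonneg_left (by positivity) (by positivity) hD8
      refine hb48.trans (e48.le.trans (step2.trans ?_))
      rw [show -((r - rmax) * (g r / (r ^ 2 + a ^ 2) ^ 3)) =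
        -((r - rmax) * g r) / (r ^ 2 + a ^ 2) ^ 3 by ring,
        div_le_div_iff_of_pos_right (pow_pos hD 3)]
      rcases le_or_gt rmax r with hle | hgt
      · -- `r ≥ r_max`: `g r ≤ −(c̃/6)Λ(r³ − r_max³)`
        have hG := hGanti (show rmax ∈ Ici r₁ from hrmax.1.le) (show r ∈ Ici r₁ from hrr₁) hle
        simp only at hG
        rw [hGrmax] at hG
        have hg1 : g r ≤ -(ct / 6 * Λ * (r ^ 3 - rmax ^ 3)) := by linarith only [hG]
        have hint : 0 ≤ rmax * (r - rmax) * (r + rmax) :=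
          mul_nonneg (mul_nonneg hrmax0.le (sub_nonneg.2 hle)) (by positivity)
        have hcub : (r - rmax) * r ^ 2 ≤ r ^ 3 - rmax ^ 3 := by linarith only [hint]
        have h1 := mul_le_mul_of_nonneg_left hcub
          (by positivity : (0 : ℝ) ≤ ct / 6 * Λ * (r - rmax))
        have h2 := mul_le_mul_of_nonneg_left hg1 (sub_nonneg.2 hle)
        linarith only [h1, h2]
      · -- `r₁' ≤ r < r_max`: `g r ≥ (c̃/6)Λ(r_max³ − r³)`
        have hG := hGanti (show r ∈ Ici r₁ from hrr₁) (show rmax ∈ Ici r₁ from hrmax.1.le) hgt.le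
        simp only at hG
        rw [hGrmax] at hG
        have hg1 : ct / 6 * Λ * (rmax ^ 3 - r ^ 3) ≤ g r := by linarith only [hG]
        have hint : 0 ≤ rmax * (rmax - r) * (rmax + r) :=
          mul_nonneg (mul_nonneg hrmax0.le (sub_nonneg.2 hgt.le)) (by positivity)
        have hcub : (rmax - r) * r ^ 2 ≤ rmax ^ 3 - r ^ 3 := by linarith only [hint]
        have h1 := mul_le_mul_of_nonneg_left hcub
          (by positivity : (0 : ℝ) ≤ ct / 6 * Λ * (rmax - r))
        have h2 := mul_le_mul_of_nonneg_left hg1 (sub_nonneg.2 hgt.le)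
        linarith only [h1, h2]
  -- (3) `d²V/dr²(r_max) ≤ −bΛ`
  have hderiv2 : deriv (deriv V) rmax = deriv g rmax / (rmax ^ 2 + a ^ 2) ^ 3 := by
    have hq := (hg_hasDeriv rmax hrmax0).div (hasDerivAt_sq_add_sq_pow a 3 rmax)
      (pow_ne_zero 3 hDm.ne')
    have heq : deriv V =ᶠ[𝓝 rmax] fun s ↦ g s / (s ^ 2 + a ^ 2) ^ 3 := by
      filter_upwards [Ioi_mem_nhds hrmax0] with s hs
      exact hVg s hs
    rw [(hq.congr_of_eventuallyEq heq).deriv, hgrmax, zero_mul, sub_zero,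
      pow_two ((rmax ^ 2 + a ^ 2) ^ 3), mul_div_mul_right _ _ (pow_ne_zero 3 hDm.ne')]
  have hnondeg : deriv (deriv V) rmax ≤ -(b * Λ) := by
    rw [hderiv2, div_le_iff₀ (pow_pos hDm 3)]
    have h1 := hg'far rmax hrmax.1.le
    have har : a ^ 2 ≤ rmax ^ 2 := ha2.trans (pow_le_pow_left₀ hM.le hrmaxM 2)
    have hD8 : (rmax ^ 2 + a ^ 2) ^ 3 ≤ 8 * rmax ^ 6 := by
      have h2r : rmax ^ 2 + a ^ 2 ≤ 2 * rmax ^ 2 := by linarith only [har]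
      calc (rmax ^ 2 + a ^ 2) ^ 3 ≤ (2 * rmax ^ 2) ^ 3 := by gcongr
        _ = 8 * rmax ^ 6 := by ring
    have h2 : b * Λ * (8 * rmax ^ 6) ≤ ct / 2 * Λ * rmax ^ 2 := by
      have hr4 : rmax ^ 4 ≤ 2401 * M ^ 4 := by
        calc rmax ^ 4 ≤ (7 * M) ^ 4 := pow_le_pow_left₀ hrmax0.le hrmax.2.le 4
          _ = 2401 * M ^ 4 := by ring
      have e1 : b * Λ * (8 * rmax ^ 6) = (8 * b * Λ * rmax ^ 2) * rmax ^ 4 := by ring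
      have e2 : ct / 2 * Λ * rmax ^ 2 = (ct / (4802 * M ^ 4) * Λ * rmax ^ 2) * (2401 * M ^ 4) := by
        field_simp; ring
      rw [e1, e2]
      have h8b : 8 * b ≤ ct / (4802 * M ^ 4) := by
        rw [le_div_iff₀ (by positivity)] at hb4 ⊢
        linarith only [hb4]
      calc (8 * b * Λ * rmax ^ 2) * rmax ^ 4 ≤ (8 * b * Λ * rmax ^ 2) * (2401 * M ^ 4) := by
            gcongr
        _ ≤ (ct / (4802 * M ^ 4) * Λ * rmax ^ 2) * (2401 * M ^ 4) := by gcongr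
    have h3 : -(b * Λ) * (8 * rmax ^ 6) ≤ -(b * Λ) * (rmax ^ 2 + a ^ 2) ^ 3 :=
      mul_le_mul_of_nonpos_left hD8 (by nlinarith only [hb0, hΛ])
    linarith only [h1, h2, h3]
  have hfar : rPlus M a + δ ≤ rmax := by linarith only [hr₁p, hrmax.1, hδδ₂]
  exact ⟨rmax, hrmaxp, hrmax.2, hfar, h07, hVpos, hVzero, hVneg, hVmax.2.2, hdist, hnear, hVdeg,
    hnondeg⟩

/-! ### Lemma 8.3.1 -/

/-- **DRSR Lemma 8.3.1 (structure of `V = V₀ + V₁` in the large superradiant range), for the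
repaired strip, with `ω_high`-largeness expressed through `Λ` — proved.** For `0 < M`,
`0 ≤ a < M` there are `α₀ > 0`, `Λ₀`, `δ > 0`, `b > 0`, `B` such that for every `0 ≤ α ≤ α₀` and
every admissible triple `(ω, m, Λ)` with `Λ ≥ Λ₀` and `0 < mω ≤ am²/(2Mr₊) + α|m|√Λ` there are
`r_max ∈ [r₊ + δ, 7M)`, `r⁰_max ∈ (r₊, 7M)` with:
`dV₀/dr(r⁰_max) = 0` and `r⁰_max` is the maximum of `V₀` on `(r₊, ∞)` (Lemma 6.4.2);
`dV/dr > 0` on `(r₊, r_max)`, `dV/dr(r_max) = 0`, `dV/dr < 0` on `(r_max, ∞)` and `r_max` is the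
maximum of `V` on `(r₊, ∞)`; `|r_max − r⁰_max| ≤ B/Λ`; `V(r) − ω² ≥ bΛ` for
`r ∈ (r_max − δ, r_max + δ)`; `bΛ(r − r_max)²/r⁴ ≤ −(r − r_max) dV/dr(r)` for all `r > r₊`
((eq:Vdeg)); `d²V/dr²(r_max) ≤ −bΛ`. See the module docstring for the correspondence with the
printed statement and for the proof. [cite: DafermosRodnianskiShlapentokhrothman2014, Lemma 8.3.1] -/
theorem exists_sepPotential_structure_of_isNearSuperradiant' {M a : ℝ} (hM : 0 < M) (ha0 : 0 ≤ a)
    (haM : a < M) :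
    ∃ α₀ > 0, ∃ Λ₀ : ℝ, ∃ δ > 0, ∃ b > 0, ∃ B : ℝ, ∀ α : ℝ, 0 ≤ α → α ≤ α₀ →
      ∀ (ω : ℝ) (m : ℤ) (Λ : ℝ), IsAdmissibleTriple a ω m Λ → Λ₀ ≤ Λ → 0 < (m : ℝ) * ω →
      (m : ℝ) * ω ≤ a * (m : ℝ) ^ 2 / (2 * M * rPlus M a) + α * (|(m : ℝ)| * √Λ) →
      ∃ rmax r0max : ℝ, rPlus M a < rmax ∧ rmax < 7 * M ∧ rPlus M a + δ ≤ rmax ∧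
        rPlus M a < r0max ∧ r0max < 7 * M ∧
        deriv (sepPotential₀ M a ω m Λ) r0max = 0 ∧
        IsMaxOn (sepPotential₀ M a ω m Λ) (Ioi (rPlus M a)) r0max ∧
        (∀ r ∈ Ioo (rPlus M a) rmax, 0 < deriv (sepPotential M a ω m Λ) r) ∧
        deriv (sepPotential M a ω m Λ) rmax = 0 ∧
        (∀ r ∈ Ioi rmax, deriv (sepPotential M a ω m Λ) r < 0) ∧
        IsMaxOn (sepPotential M a ω m Λ) (Ioi (rPlus M a)) rmax ∧
        |rmax - r0max| ≤ B / Λ ∧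
        (∀ r ∈ Ioo (rmax - δ) (rmax + δ), b * Λ ≤ sepPotential M a ω m Λ r - ω ^ 2) ∧
        (∀ r ∈ Ioi (rPlus M a),
          b * Λ * (r - rmax) ^ 2 / r ^ 4 ≤ -((r - rmax) * deriv (sepPotential M a ω m Λ) r)) ∧
        deriv (deriv (sepPotential M a ω m Λ)) rmax ≤ -(b * Λ) := by
  have haM' : |a| ≤ M := by rw [abs_of_nonneg ha0]; exact haM.le
  have ha2 : a ^ 2 ≤ M ^ 2 := by nlinarith only [haM, ha0]
  have hrp : M < rPlus M a := by
    have : 0 < √(M ^ 2 - a ^ 2) := Real.sqrt_pos.2 (by nlinarith only [haM, ha0])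
    unfold rPlus; linarith only [this]
  have hrp0 : 0 < rPlus M a := hM.trans hrp
  have hDp : 0 < rPlus M a ^ 2 + a ^ 2 := by positivity
  -- §6: Lemma 6.4.2 for the repaired strip
  obtain ⟨α₀, hα₀, b₀, hb₀, H6⟩ := exists_sepPotential₀_rmax_sub_sq_ge' hM ha0 haM
  -- Lemma 6.4.1: `P(r₊) ≥ (B₀ − Dα)Λ ≥ (B₀/2)Λ` for `α ≤ B₀/(2(D + 1))`
  obtain ⟨B₀, hB₀def⟩ : ∃ B₀ : ℝ, B₀ = 4 * (rPlus M a - M) * (M * rPlus M a - a ^ 2) := ⟨_, rfl⟩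
  obtain ⟨D, hDdef⟩ : ∃ D : ℝ, D = 4 * a * M * (3 * rPlus M a ^ 2 - a ^ 2) := ⟨_, rfl⟩
  have hB₀ : 0 < B₀ := by
    have h1 : 0 < rPlus M a - M := sub_pos.2 hrp
    have h2 : 0 < M * rPlus M a - a ^ 2 := by
      nlinarith only [mul_lt_mul_of_pos_left hrp hM, ha2]
    rw [hB₀def]; positivity
  have hD0 : 0 ≤ D := by
    have : a ^ 2 ≤ 3 * rPlus M a ^ 2 := by nlinarith only [ha2, hrp, hM]
    rw [hDdef]; exact mul_nonneg (by positivity) (by linarith only [this])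
  obtain ⟨Λ₀, δ, hδ, b, hb, B, Hcore⟩ :=
    exists_sepPotential_structure_of_horizon_deriv hM ha0 haM (half_pos hB₀) hb₀
  refine ⟨min α₀ (B₀ / (2 * (D + 1))), lt_min hα₀ (by positivity), max Λ₀ 1, δ, hδ, b, hb, B,
    fun α hα hαle ω m Λ hadm hΛ₀Λ hpos hstrip ↦ ?_⟩
  have hΛ : 0 < Λ := lt_of_lt_of_le one_pos ((le_max_right _ _).trans hΛ₀Λ)
  have hΛ₀ : Λ₀ ≤ Λ := (le_max_left _ _).trans hΛ₀Λ
  have hαα₀ : α ≤ α₀ := hαle.trans (min_le_left _ _)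
  have hαB : α ≤ B₀ / (2 * (D + 1)) := hαle.trans (min_le_right _ _)
  obtain ⟨r0max, h0p, -, h0max, h0d, -, h0b⟩ := H6 α hα hαα₀ ω m Λ hadm hpos hstrip
  have hPrp : B₀ / 2 * Λ ≤ critPoly M a ω m Λ (rPlus M a) := by
    have h := le_deriv_sepPotential₀_rPlus_alpha' hM ha0 haM hadm hα hstrip
    have h' : (B₀ - D * α) * Λ / (rPlus M a ^ 2 + a ^ 2) ^ 3 ≤
        deriv (sepPotential₀ M a ω m Λ) (rPlus M a) := by
      convert h using 1; rw [hB₀def, hDdef]; ring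
    rw [deriv_sepPotential₀_eq M a ω m Λ hDp.ne', div_le_div_iff_of_pos_right (pow_pos hDp 3)]
      at h'
    have hDα : D * α ≤ B₀ / 2 := by
      have h1 : D * α ≤ D * (B₀ / (2 * (D + 1))) := mul_le_mul_of_nonneg_left hαB hD0
      have h2 : D * (B₀ / (2 * (D + 1))) ≤ B₀ / 2 := by
        rw [mul_div_assoc', div_le_div_iff₀ (by positivity) (by norm_num)]
        nlinarith only [hB₀, hD0]
      exact h1.trans h2
    have : B₀ / 2 * Λ ≤ (B₀ - D * α) * Λ :=
      mul_le_mul_of_nonneg_right (by linarith only [hDα]) hΛ.le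
    exact this.trans h'
  obtain ⟨rmax, h1, h2, h2', h3, h4, h5, h6, h7, h8, h9, h10, h11⟩ :=
    Hcore ω m Λ hadm hΛ₀ hPrp r0max h0p h0d h0b
  exact ⟨rmax, r0max, h1, h2, h2', h0p, h3, h0d, h0max, h4, h5, h6, h7, h8, h9, h10, h11⟩

/-- **Lemma 8.3.1 phrased with the range `𝓖^♯(ω_high)` (repaired strip): "for sufficiently large
`ω_high` and `(ω, m, Λ) ∈ 𝓖^♯(ω_high)` …".** For `0 < M`, `0 ≤ a < M` there are `α₀ > 0`, `ω₀`,
`δ > 0`, `b > 0`, `B` such that for all `0 ≤ α ≤ α₀`, all `ω_high ≥ ω₀` and all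
`(ω, m, Λ) ∈ 𝓖^♯(ω_high)` (`IsFreqSharpSup` with the strip `IsNearSuperradiant' M a α`: admissible,
`ω²_high ≤ (ω₊ + α)²Λ`, `0 < mω ≤ ω₊m² + α|m|√Λ`) the conclusions of
`exists_sepPotential_structure_of_isNearSuperradiant'` hold (membership gives `Λ ≥ Λ₀` once
`ω²_high ≥ (ω₊ + α₀)²Λ₀`). DRSR arXiv:1402.7034, Lemma 8.3.1.
[cite: DafermosRodnianskiShlapentokhrothman2014, Lemma 8.3.1] -/
theorem exists_sepPotential_structure_of_isFreqSharpSup' {M a : ℝ} (hM : 0 < M) (ha0 : 0 ≤ a)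
    (haM : a < M) :
    ∃ α₀ > 0, ∃ ω₀ : ℝ, ∃ δ > 0, ∃ b > 0, ∃ B : ℝ, ∀ α : ℝ, 0 ≤ α → α ≤ α₀ →
      ∀ ωh : ℝ, ω₀ ≤ ωh → ∀ (ω : ℝ) (m : ℤ) (Λ : ℝ),
      IsFreqSharpSup (IsNearSuperradiant' M a α) M a α ωh ω m Λ →
      ∃ rmax r0max : ℝ, rPlus M a < rmax ∧ rmax < 7 * M ∧ rPlus M a + δ ≤ rmax ∧
        rPlus M a < r0max ∧ r0max < 7 * M ∧
        deriv (sepPotential₀ M a ω m Λ) r0max = 0 ∧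
        IsMaxOn (sepPotential₀ M a ω m Λ) (Ioi (rPlus M a)) r0max ∧
        (∀ r ∈ Ioo (rPlus M a) rmax, 0 < deriv (sepPotential M a ω m Λ) r) ∧
        deriv (sepPotential M a ω m Λ) rmax = 0 ∧
        (∀ r ∈ Ioi rmax, deriv (sepPotential M a ω m Λ) r < 0) ∧
        IsMaxOn (sepPotential M a ω m Λ) (Ioi (rPlus M a)) rmax ∧
        |rmax - r0max| ≤ B / Λ ∧
        (∀ r ∈ Ioo (rmax - δ) (rmax + δ), b * Λ ≤ sepPotential M a ω m Λ r - ω ^ 2) ∧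
        (∀ r ∈ Ioi (rPlus M a),
          b * Λ * (r - rmax) ^ 2 / r ^ 4 ≤ -((r - rmax) * deriv (sepPotential M a ω m Λ) r)) ∧
        deriv (deriv (sepPotential M a ω m Λ)) rmax ≤ -(b * Λ) := by
  obtain ⟨α₀, hα₀, Λ₀, δ, hδ, b, hb, B, H⟩ :=
    exists_sepPotential_structure_of_isNearSuperradiant' hM ha0 haM
  set p := horizonAngularVelocity M a with hp
  have hp0 : 0 ≤ p := horizonAngularVelocity_nonneg hM.le ha0
  refine ⟨α₀, hα₀, max 1 ((p + α₀) * √(max Λ₀ 0)), δ, hδ, b, hb, B,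
    fun α hα hαle ωh hωh ω m Λ hG ↦ ?_⟩
  obtain ⟨hadm, hthr, hstrip⟩ := hG
  have hωh1 : 1 ≤ ωh := le_trans (le_max_left _ _) hωh
  have hωh2 : (p + α₀) * √(max Λ₀ 0) ≤ ωh := le_trans (le_max_right _ _) hωh
  -- `Λ ≥ Λ₀` from the threshold
  have hΛ : Λ₀ ≤ Λ := by
    have hq : 0 < (p + α) ^ 2 := by
      rcases (sq_nonneg (p + α)).lt_or_eq with h | h
      · exact h
      · exfalso; rw [← h, zero_mul] at hthr; nlinarith only [hthr, hωh1]
    have h1 : (p + α) ^ 2 * max Λ₀ 0 ≤ (p + α₀) ^ 2 * max Λ₀ 0 := by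
      apply mul_le_mul_of_nonneg_right _ (le_max_right _ _)
      exact pow_le_pow_left₀ (by positivity) (by linarith only [hαle]) 2
    have h2 : (p + α₀) ^ 2 * max Λ₀ 0 ≤ ωh ^ 2 := by
      have h0 : 0 ≤ (p + α₀) * √(max Λ₀ 0) := by positivity
      calc (p + α₀) ^ 2 * max Λ₀ 0 = ((p + α₀) * √(max Λ₀ 0)) ^ 2 := by
            rw [mul_pow, Real.sq_sqrt (le_max_right _ _)]
        _ ≤ ωh ^ 2 := pow_le_pow_left₀ h0 hωh2 2
    have h3 : (p + α) ^ 2 * max Λ₀ 0 ≤ (p + α) ^ 2 * Λ := h1.trans (h2.trans hthr)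
    exact (le_max_left Λ₀ 0).trans (le_of_mul_le_mul_left h3 hq)
  have hstrip' : (m : ℝ) * ω ≤ a * (m : ℝ) ^ 2 / (2 * M * rPlus M a) + α * (|(m : ℝ)| * √Λ) := by
    have h := hstrip.2
    rwa [horizonAngularVelocity_mul_sq] at h
  exact H α hα hαle ω m Λ hadm hΛ hstrip.1 hstrip'

/-- **The same structure for `mω ≤ 0` and `ω² ≤ (16/(4225M²))Λ`** — the situation of the range
`𝓖_𝄬` ("`ω² ≪ Λ`", where `mω ≤ 0` by `KerrFrequencyRanges.mul_nonpos_of_isFreqLessflat'`), for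
which DRSR arXiv:1402.7034, proof of Prop. 8.5.1, assert: "Lemma 6.4.1 applies, and we may thus
conclude that the potential `V₀` is increasing at `r₊`, and hence has only one critical point at
`r = r⁰_max` where it attains a maximum. As in the proof of Proposition 8.3.1 … we again infer that …
the potential `V` has a unique non-degenerate critical point at `r_max`, where it attains a maximum,
and that `r_max` is uniformly bounded away from `r₊` and is uniformly bounded from above. Similarly,
we also obtain … `V(r) − ω² ≥ bΛ ∀ r ∈ (r_max − δ, r_max + δ)` and
`(r − r_max) dV/dr ≥ bΛ(r − r_max)²/r⁴`" [sic, for `−(r − r_max)dV/dr`]. Inputs: `P(r₊) ≥ B₀Λ`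
(`le_deriv_sepPotential₀_rPlus`, `mω ≤ 0 ≤ am²/(2Mr₊)`), case (b) of Lemma 6.3.1
(`sepPotential₀_caseB_of_deriv_rPlus_pos`), and `V₀(r⁰_max) ≥ V₀(8M) ≥ 32Λ/(4225M²)`
(`sepPotential₀_eight_mul_ge`). [cite: DafermosRodnianskiShlapentokhrothman2014, Prop. 8.5.1 (proof)] -/
theorem exists_sepPotential_structure_of_mul_nonpos {M a : ℝ} (hM : 0 < M) (ha0 : 0 ≤ a)
    (haM : a < M) :
    ∃ Λ₀ : ℝ, ∃ δ > 0, ∃ b > 0, ∃ B : ℝ, ∀ (ω : ℝ) (m : ℤ) (Λ : ℝ), IsAdmissibleTriple a ω m Λ →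
      Λ₀ ≤ Λ → (m : ℝ) * ω ≤ 0 → ω ^ 2 ≤ 16 / (4225 * M ^ 2) * Λ →
      ∃ rmax r0max : ℝ, rPlus M a < rmax ∧ rmax < 7 * M ∧ rPlus M a + δ ≤ rmax ∧
        rPlus M a < r0max ∧ r0max < 7 * M ∧
        deriv (sepPotential₀ M a ω m Λ) r0max = 0 ∧
        IsMaxOn (sepPotential₀ M a ω m Λ) (Ioi (rPlus M a)) r0max ∧
        (∀ r ∈ Ioo (rPlus M a) rmax, 0 < deriv (sepPotential M a ω m Λ) r) ∧
        deriv (sepPotential M a ω m Λ) rmax = 0 ∧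
        (∀ r ∈ Ioi rmax, deriv (sepPotential M a ω m Λ) r < 0) ∧
        IsMaxOn (sepPotential M a ω m Λ) (Ioi (rPlus M a)) rmax ∧
        |rmax - r0max| ≤ B / Λ ∧
        (∀ r ∈ Ioo (rmax - δ) (rmax + δ), b * Λ ≤ sepPotential M a ω m Λ r - ω ^ 2) ∧
        (∀ r ∈ Ioi (rPlus M a),
          b * Λ * (r - rmax) ^ 2 / r ^ 4 ≤ -((r - rmax) * deriv (sepPotential M a ω m Λ) r)) ∧
        deriv (deriv (sepPotential M a ω m Λ)) rmax ≤ -(b * Λ) := by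
  have haM' : |a| ≤ M := by rw [abs_of_nonneg ha0]; exact haM.le
  have hMa : IsSubextremal M a := show |a| < M by rwa [abs_of_nonneg ha0]
  have ha2 : a ^ 2 ≤ M ^ 2 := by nlinarith only [haM, ha0]
  have hrp : M < rPlus M a := by
    have : 0 < √(M ^ 2 - a ^ 2) := Real.sqrt_pos.2 (by nlinarith only [haM, ha0])
    unfold rPlus; linarith only [this]
  have hrp0 : 0 < rPlus M a := hM.trans hrp
  have hrp2 : rPlus M a ≤ 2 * M := by
    have : √(M ^ 2 - a ^ 2) ≤ M := by
      rw [Real.sqrt_le_left hM.le]; linarith only [sq_nonneg a]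
    unfold rPlus; linarith only [this]
  have hDp : 0 < rPlus M a ^ 2 + a ^ 2 := by positivity
  obtain ⟨B₀, hB₀def⟩ : ∃ B₀ : ℝ, B₀ = 4 * (rPlus M a - M) * (M * rPlus M a - a ^ 2) := ⟨_, rfl⟩
  have hB₀ : 0 < B₀ := by
    have h1 : 0 < rPlus M a - M := sub_pos.2 hrp
    have h2 : 0 < M * rPlus M a - a ^ 2 := by
      nlinarith only [mul_lt_mul_of_pos_left hrp hM, ha2]
    rw [hB₀def]; positivity
  have hb₀ : (0 : ℝ) < 16 / (4225 * M ^ 2) := by positivity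
  obtain ⟨Λ₀, δ, hδ, b, hb, B, Hcore⟩ :=
    exists_sepPotential_structure_of_horizon_deriv hM ha0 haM hB₀ hb₀
  refine ⟨max Λ₀ 1, δ, hδ, b, hb, B, fun ω m Λ hadm hΛ₀Λ hmω hω2 ↦ ?_⟩
  have hΛ : 0 < Λ := lt_of_lt_of_le one_pos ((le_max_right _ _).trans hΛ₀Λ)
  have hΛ₀ : Λ₀ ≤ Λ := (le_max_left _ _).trans hΛ₀Λ
  -- Lemma 6.4.1: `P(r₊) ≥ B₀Λ > 0`
  have hsr : (m : ℝ) * ω ≤ a * (m : ℝ) ^ 2 / (2 * M * rPlus M a) :=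
    hmω.trans (by positivity)
  have hd := le_deriv_sepPotential₀_rPlus hM ha0 haM hadm hsr
  have hPrp : B₀ * Λ ≤ critPoly M a ω m Λ (rPlus M a) := by
    have h' : B₀ * Λ / (rPlus M a ^ 2 + a ^ 2) ^ 3 ≤ deriv (sepPotential₀ M a ω m Λ) (rPlus M a) := by
      convert hd using 1; rw [hB₀def]
    rwa [deriv_sepPotential₀_eq M a ω m Λ hDp.ne', div_le_div_iff_of_pos_right (pow_pos hDp 3)]
      at h'
  have hdpos : 0 < deriv (sepPotential₀ M a ω m Λ) (rPlus M a) :=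
    (deriv_sepPotential₀_pos_iff M a ω m Λ hrp0).2 (lt_of_lt_of_le (by positivity) hPrp)
  -- Lemma 6.3.1 (b): the unique critical point `r⁰_max` of `V₀`, its maximum
  obtain ⟨r0max, h0p, h07, h0pos', h0d, h0neg⟩ :=
    sepPotential₀_caseB_of_deriv_rPlus_pos hMa hadm hΛ hdpos
  have h0max := (sepPotential₀_isMaxOn_of_deriv_sign (ω := ω) (m := m) (Λ := Λ) hMa h0p h0pos'
    h0neg).2.2
  -- `V₀(r⁰_max) − ω² ≥ V₀(8M) − ω² ≥ (16/(4225M²))Λ`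
  have h0b : 16 / (4225 * M ^ 2) * Λ ≤ sepPotential₀ M a ω m Λ r0max - ω ^ 2 := by
    have h8 : sepPotential₀ M a ω m Λ (8 * M) ≤ sepPotential₀ M a ω m Λ r0max :=
      h0max (show 8 * M ∈ Ioi (rPlus M a) by
        show rPlus M a < 8 * M; linarith only [hrp2, hM])
    have h8' := sepPotential₀_eight_mul_ge (ω := ω) (m := m) hM haM' hadm
    have e : 32 * Λ / (4225 * M ^ 2) = 2 * (16 / (4225 * M ^ 2) * Λ) := by ring
    linarith only [h8, h8', hω2, e.le, e.ge]
  obtain ⟨rmax, h1, h2, h2', h3, h4, h5, h6, h7, h8, h9, h10, h11⟩ :=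
    Hcore ω m Λ hadm hΛ₀ hPrp r0max h0p h0d h0b
  exact ⟨rmax, r0max, h1, h2, h2', h0p, h3, h0d, h0max, h4, h5, h6, h7, h8, h9, h10, h11⟩

/-- **The structure of `V` in the range `𝓖_𝄬(ω_high, ε_width)` (repaired strip)**, as used in
the proof of DRSR arXiv:1402.7034, Prop. 8.5.1 ("for all `ω_high`, `ε_width⁻¹` sufficiently
large"): for `0 < M`, `0 ≤ a < M` and `α ≥ 0` there are `ε₀ > 0`, `ω₀`, `δ > 0`, `b > 0`, `B` such
that for all `0 < ε ≤ min(ε₀, α²)`, `ω_high ≥ ω₀` and `(ω, m, Λ) ∈ 𝓖_𝄬(ω_high, ε)`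
(`IsFreqLessflat` with the strip `IsNearSuperradiant' M a α`: admissible, `ε⁻¹ω²_high ≤ Λ`,
`ω² < εΛ`, off the strip) the conclusions of `exists_sepPotential_structure_of_mul_nonpos` hold
(`mω ≤ 0` by `mul_nonpos_of_isFreqLessflat'`, `ε ≤ ε₀ = 16/(4225M²)`, and `Λ ≥ ε⁻¹ω²_high ≥ Λ₀`
once `ε ≤ 1 ≤ ω₀ ≤ ω_high` and `ω²_high ≥ Λ₀`). [cite: DafermosRodnianskiShlapentokhrothman2014, Prop. 8.5.1 (proof)] -/
theorem exists_sepPotential_structure_of_isFreqLessflat' {M a α : ℝ} (hM : 0 < M) (ha0 : 0 ≤ a)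
    (haM : a < M) (hα : 0 ≤ α) :
    ∃ ε₀ > 0, ∃ ω₀ : ℝ, ∃ δ > 0, ∃ b > 0, ∃ B : ℝ, ∀ ε : ℝ, 0 < ε → ε ≤ ε₀ → ε ≤ α ^ 2 →
      ∀ ωh : ℝ, ω₀ ≤ ωh → ∀ (ω : ℝ) (m : ℤ) (Λ : ℝ),
      IsFreqLessflat (IsNearSuperradiant' M a α) a ωh ε ω m Λ →
      ∃ rmax r0max : ℝ, rPlus M a < rmax ∧ rmax < 7 * M ∧ rPlus M a + δ ≤ rmax ∧
        rPlus M a < r0max ∧ r0max < 7 * M ∧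
        deriv (sepPotential₀ M a ω m Λ) r0max = 0 ∧
        IsMaxOn (sepPotential₀ M a ω m Λ) (Ioi (rPlus M a)) r0max ∧
        (∀ r ∈ Ioo (rPlus M a) rmax, 0 < deriv (sepPotential M a ω m Λ) r) ∧
        deriv (sepPotential M a ω m Λ) rmax = 0 ∧
        (∀ r ∈ Ioi rmax, deriv (sepPotential M a ω m Λ) r < 0) ∧
        IsMaxOn (sepPotential M a ω m Λ) (Ioi (rPlus M a)) rmax ∧
        |rmax - r0max| ≤ B / Λ ∧
        (∀ r ∈ Ioo (rmax - δ) (rmax + δ), b * Λ ≤ sepPotential M a ω m Λ r - ω ^ 2) ∧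
        (∀ r ∈ Ioi (rPlus M a),
          b * Λ * (r - rmax) ^ 2 / r ^ 4 ≤ -((r - rmax) * deriv (sepPotential M a ω m Λ) r)) ∧
        deriv (deriv (sepPotential M a ω m Λ)) rmax ≤ -(b * Λ) := by
  obtain ⟨Λ₀, δ, hδ, b, hb, B, H⟩ := exists_sepPotential_structure_of_mul_nonpos hM ha0 haM
  refine ⟨min (16 / (4225 * M ^ 2)) 1, lt_min (by positivity) one_pos, max 1 (√(max Λ₀ 0)), δ, hδ,
    b, hb, B, fun ε hε hεle hεα ωh hωh ω m Λ hG ↦ ?_⟩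
  have hε16 : ε ≤ 16 / (4225 * M ^ 2) := hεle.trans (min_le_left _ _)
  have hε1 : ε ≤ 1 := hεle.trans (min_le_right _ _)
  have hmω : (m : ℝ) * ω ≤ 0 := mul_nonpos_of_isFreqLessflat' hM.le ha0 hα hεα hG
  obtain ⟨hadm, hthr, hω2, -⟩ := hG
  have hΛ0 : 0 ≤ Λ := hadm.nonneg
  have hωh1 : 1 ≤ ωh := le_trans (le_max_left _ _) hωh
  have hωh2 : √(max Λ₀ 0) ≤ ωh := le_trans (le_max_right _ _) hωh
  -- `Λ ≥ ε⁻¹ ω²_high ≥ ω²_high ≥ Λ₀`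
  have hΛ : Λ₀ ≤ Λ := by
    have h1 : max Λ₀ 0 ≤ ωh ^ 2 := by
      calc max Λ₀ 0 = (√(max Λ₀ 0)) ^ 2 := (Real.sq_sqrt (le_max_right _ _)).symm
        _ ≤ ωh ^ 2 := pow_le_pow_left₀ (Real.sqrt_nonneg _) hωh2 2
    have h2 : ωh ^ 2 ≤ ε⁻¹ * ωh ^ 2 := by
      have : 1 ≤ ε⁻¹ := (one_le_inv₀ hε).2 hε1
      nlinarith only [this, sq_nonneg ωh]
    exact (le_max_left Λ₀ 0).trans (h1.trans (h2.trans hthr))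
  have hω2' : ω ^ 2 ≤ 16 / (4225 * M ^ 2) * Λ :=
    hω2.le.trans (mul_le_mul_of_nonneg_right hε16 hΛ0)
  exact H ω m Λ hadm hΛ hmω hω2'

end Kerr

end Literature.Geometry.Lorentzian

end
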